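import Literature.AlgebraicGeometry.HodgeTheory.BettiHodgeConjectureSquareOffMiddleAlgebraic
import Literature.AlgebraicGeometry.HodgeTheory.BettiHodgeConjectureProductAlgebraicCohomologyFactor
import Literature.AlgebraicGeometry.HodgeTheory.BettiHodgeConjectureProductNoExceptionalClasses
import HarnessLib

/-!
# Products with an off-middle-algebraic factor: `HC(Y × Z)` from `HC(Y)`, `HC(Z)` and the pieces `Hᵐ(Y) ⊗ Hʲ(Z)`; smooth hypersurfaces of odd dimension times varieties without odd
# cohomology, times even-dimensional hypersurfaces with `HC`, times odd-dimensional hypersurfaces with no middle Hodge classes, and their squares when `End_HS(Hᵐ) = ℚ`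
# (Voisin I §11.3.3 Lemma 11.41 / Thm. 11.38–11.40; Voisin II §1.2.3 Cor. 1.24–1.25; Arapura 2001 Lemma 9 / Cor. 10)

Family `hodge`, lane `lit-hodgefound` (Track 2 foundations library; Layers A1/A4), layer `Literature/AlgebraicGeometry/HodgeTheory`.  THEOREMS ONLY (no definition, no named fact, no instance;
D-0026 net debt `0`).  Sequel of the seat's g29-#2 (`BettiKunnethPiecesHardLefschetzReduction`: `HC(Y × Z)` follows from `HC(Y)`, `HC(Z)` and the algebraicity of the Hodge classes of the Künneth
pieces `Hⁱ(Y) ⊗ Hʲ(Z)`, `1 ≤ i ≤ m`, `1 ≤ j ≤ n`) and g29-#6 (`BettiHodgeConjectureSquareOffMiddleAlgebraic`: pieces with a pure even factor or a zero factor are harmless; `HC(X × X)` for `X`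
OFF-MIDDLE ALGEBRAIC — `Hᵏ(X;ℚ) = 0` for odd `k ≠ dim X`, `Hdgᵖ(H^{2p}X) = H^{2p}(X;ℚ)` for `2p ≠ dim X` — with `HC(X)` and `dim End_HS(H^{dim X}X) ≤ 1`).  Here the SAME mechanism is run with
only ONE off-middle-algebraic factor, and then READ ON SMOOTH HYPERSURFACES through the tree's PROVED Lefschetz hyperplane theorems.

WHAT IS PROVED.
* §1 ONE OFF-MIDDLE-ALGEBRAIC FACTOR.  **`BettiUniverse.hodgeConjectureFor_tensor_of_offMiddle_algebraic_left`**: for `Y` (dimension `m`) off-middle algebraic with `HC(Y)` and any `Z` (dimension `n`)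
  with `HC(Z)`, `HC(Y × Z)` holds as soon as the Hodge classes of the pieces `Hᵐ(Y) ⊗ Hʲ(Z)`, `1 ≤ j ≤ n`, `m + j` even, have algebraic cross products — every other piece `Hⁱ(Y) ⊗ Hʲ(Z)`
  is zero (`i` odd) or has the pure factor `Hⁱ(Y) = Hdg(HⁱY)` of algebraic classes (`i` even; Deligne 2.1.13 / Voisin I Lemma 11.41: its Hodge classes are `Hⁱ(Y) ⊗ Hdg(HʲZ)`, exterior
  products of algebraic classes); mirror `…_right`.  **`BettiUniverse.hodgeConjectureFor_tensor_of_offMiddle_algebraic`** (BOTH factors off-middle algebraic: only the piece `Hᵐ(Y) ⊗ Hⁿ(Z)`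
  matters), `…_of_hodgeClasses_eq_bot` / `…_of_subsingleton_hom` (no Hodge class in `Hᵐ(Y) ⊗ Hⁿ(Z)`, i.e. `Hom_HS(HᵐY, HⁿZ(s)) = 0`, `n − 2s = m`).  (When one factor has NO odd cohomology at
  all, the seat's g27-#5 `BettiUniverse.hodgeConjectureFor_tensor_of_pure_even_of_odd_vanishing` already gives `HC(Y × Z) ⟸ HC(Y), HC(Z)`; it is used, not restated, in §2.)
* §2 SMOOTH HYPERSURFACES `Y ⊂ ℙ^{m+1}_ℂ` (`IsSmoothHypersurface m e Y`).  From the tree's PROVED `Voisin2003_smoothHypersurface_algebraicClasses_eq_top_holds` (Voisin II Cor. 1.24/1.25: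
  `N^p(Y) = H^{2p}(Y;ℂ)` for `2p ≠ m`) and `subsingleton_bettiCohomology_of_odd` (`Hᵏ(Y;ℚ) = 0`, `k` odd `≠ m`): `IsSmoothHypersurface.finrank_bettiCohomology_eq_zero_of_odd`,
  `IsSmoothHypersurface.hodgeClasses_hodge_eq_top_of_two_mul_ne` / `…_of_odd`, `IsSmoothHypersurface.hodgeConjectureFor_of_odd` — a smooth hypersurface is off-middle algebraic, with `HC`
  when `m` is odd.  Hence, for `m` ODD: **`IsSmoothHypersurface.hodgeConjectureFor_tensor_of_odd`** (`HC(Y × Z)` for every smooth projective `Z` with `HC(Z)` and no odd cohomology; g27-#5) and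
  its mirror, **`…_tensor_hypersurface_of_odd_of_even`** / `…_of_even_of_odd` (`Z = Y'` an even-dimensional smooth hypersurface satisfying `HC`), **`…_tensor_hypersurface_of_odd_of_odd`**
  (`Y'` an odd-dimensional smooth hypersurface and `Hdg(HᵐY ⊗ Hᵐ'Y') = 0`, with the `Hom` form `…_of_subsingleton_hom`), and the squares
  **`IsSmoothHypersurface.hodgeConjectureFor_tensor_self_of_finrank_end_le_one`** (`HC(Y × Y) ⟸ HC(Y)` and `dim End_HS(HᵐY) ≤ 1`, any `m`; for even `m` the hypothesis forces `b_m(Y) ≤ 1`)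
  and **`…_of_odd_of_finrank_end_le_one`** (`m` odd: `HC(Y × Y)` as soon as `dim End_HS(HᵐY) ≤ 1` — the general hypersurface, whose monodromy group is as big as possible).

THE PRINTS.  C. Voisin (2002) [VoisinHodgeI2002] §11.3.3 Thm. 11.38 (Künneth), Thm. 11.40 and p. 287 (the Künneth components of a Hodge / algebraic class are Hodge / algebraic), Lemma 11.41
(Hodge classes of `Hᵏ(Y) ⊗ Hˡ(Z)` ↔ morphisms of Hodge structures).  C. Voisin (2003) [VoisinHodgeII2003] §1.2.2 Thm. 1.23, §1.2.3 Cor. 1.24–1.25 (cohomology of a smooth hypersurface off the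
middle degree: `H^{odd} = 0`, `H^{2k} = ℤhᵏ` resp. `ℤα`), §9.2.4 proof of Prop. 9.20.  P. Deligne (1971) [DeligneHodgeII1971] 2.1.13.  D. Arapura (2001) [Arapura2001HodgeCyclesModuli] Lemma 9,
Cor. 10, Remark 11 (products with varieties whose cohomology is algebraic).  P. Deligne (2000/2006) [Deligne2000] §1 (the statement of `HC`).  C. Voisin (2025) [Voisin2025] §3.2.1 (12)–(14)
(Künneth components of the diagonal).

THE OBJECTS (all the tree's).  `Y Z Y' S : SchemeOver ℂ`; `IsSmoothProjective`, `IsSmoothHypersurface m e Y` (a smooth hypersurface of dimension `m` and degree `e` in `ℙ^{m+1}_ℂ`, file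
`Motives/Sweep1`); `hHD : exists_isReal_hodgeModel`; `Hᵏ(X) = BettiUniverse.hodge hHD hX k` with `hodgeClasses`; `BettiUniverse.kunnethSummand`, `BettiUniverse.crossMap`; `HodgeStructure.Hom`,
`tensor`, `tateTwist`, `cast`; `bettiCohomology`, `complexBetti`, `ofRatClass`, `algebraicClasses`, `HodgeConjectureFor`.

DEVIATIONS / SCOPE.  `dim End_HS(HᵐY) ≤ 1` for the general hypersurface (big monodromy) is NOT proved here — it enters as a hypothesis; nothing is claimed about the middle piece
`Hᵐ(Y) ⊗ Hᵐ'(Y')` beyond the two cases «no Hodge class» and «`Y = Y'`, `End_HS = ℚ`».  No definitions.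

## References
* [VoisinHodgeI2002] C. Voisin, *Hodge Theory and Complex Algebraic Geometry I* (2002) — §11.3.3 Thm. 11.38, Thm. 11.40, Lemma 11.41, p. 287.
* [VoisinHodgeII2003] C. Voisin, *Hodge Theory and Complex Algebraic Geometry II* (2003) — §1.2.2 Thm. 1.23, §1.2.3 Cor. 1.24–1.25, §9.2.4 Prop. 9.20.
* [DeligneHodgeII1971] P. Deligne, *Théorie de Hodge II* (1971) — 2.1.13.
* [Arapura2001HodgeCyclesModuli] D. Arapura, *Motivation for Hodge cycles* (2006 version of the 2001 notes) — Lemma 9, Cor. 10, Remark 11.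
* [Deligne2000] P. Deligne, *The Hodge conjecture* (Clay problem description) — §1.
* [Voisin2025] C. Voisin, *Cycle classes on algebraic varieties* (2025) — §3.2.1 (12)–(14).

## Provenance
Lane `lit-hodgefound` (Hodge path, Track 2), prover seat `lit-hodgefound-p29` (generation 29), self-proposed row g29-#7 (g29-#6 with one special factor, read on hypersurfaces).
-/

noncomputable section

open scoped TensorProduct
open CategoryTheory MonoidalCategory Module Finset
open Literature.AlgebraicTopology.SingularHomology
open Literature.Geometry.Kaehler

namespace Literature.AlgebraicGeometry.HodgeTheory

open Literature.AlgebraicGeometry.Motives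
open Literature.AlgebraicGeometry.Motives.HodgeStructure

variable {m n d : ℕ} {X Y Z : SchemeOver ℂ}

/-! ### §1 One off-middle-algebraic factor -/

section OneFactor

variable [HodgeTensorFacts.{0, 0}]

/-- **`HC(Y × Z)` with `Y` off-middle algebraic (left factor).**  Let `Y` (dimension `m`) satisfy `HC(Y)`, `Hᵏ(Y;ℚ) = 0` for odd `k ≠ m` and `Hdgᵖ(H^{2p}Y) = H^{2p}(Y;ℚ)` for `2p ≠ m`, and let `Z`
(dimension `n`) satisfy `HC(Z)`.  If the Hodge classes of the pieces `Hᵐ(Y) ⊗ Hʲ(Z)`, `1 ≤ j ≤ n`, `m + j = 2c`, have algebraic cross products, then `HC(Y × Z)`: by g29-#2 only the pieces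
`Hⁱ ⊗ Hʲ` with `1 ≤ i ≤ m`, `1 ≤ j ≤ n` matter, and for `i ≠ m` the piece is zero (`i` odd) or has the pure factor `HⁱY` of algebraic classes (`i` even; Lemma 11.41 / Deligne 2.1.13).
[cite: VoisinHodgeI2002, §11.3.3 Thm. 11.38–11.40, Lemma 11.41 and p. 287] [cite: DeligneHodgeII1971, 2.1.13] [cite: Arapura2001HodgeCyclesModuli, Lemma 9 and Cor. 10] -/
theorem BettiUniverse.hodgeConjectureFor_tensor_of_offMiddle_algebraic_left (hHD : exists_isReal_hodgeModel) (hY : IsSmoothProjective m Y) (hZ : IsSmoothProjective n Z)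
    (hYZ : IsSmoothProjective d (Y ⊗ Z)) (hHCY : HodgeConjectureFor m Y) (hHCZ : HodgeConjectureFor n Z) (hodd : ∀ k, Odd k → k ≠ m → Module.finrank ℚ (bettiCohomology Y k) = 0)
    (heven : ∀ p, 2 * p ≠ m → (BettiUniverse.hodge hHD hY (2 * p)).hodgeClasses p = ⊤)
    (hmid : ∀ (c j : ℕ) (hmj : m + j = 2 * c), 1 ≤ j → j ≤ n →
      ∀ t ∈ (BettiUniverse.kunnethSummand hHD hY hZ (2 * c) ⟨(m, j), HasAntidiagonal.mem_antidiagonal.2 hmj⟩).hodgeClasses c,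
        ofRatClass (ComplexPoints (Y ⊗ Z)) (2 * c) (BettiUniverse.crossMap Y Z hmj t) ∈ algebraicClasses (Y ⊗ Z) c) :
    HodgeConjectureFor d (Y ⊗ Z) := by
  have halgY : ∀ (p : ℕ), ∀ z ∈ (BettiUniverse.hodge hHD hY (2 * p)).hodgeClasses (p : ℤ), ofRatClass (ComplexPoints Y) (2 * p) z ∈ algebraicClasses Y p :=
    fun p z hz ↦ hHCY.2 p _ (isRationalClass_ofRatClass _) ((BettiUniverse.mem_hodgeClasses_hodge_iff_isOfHodgeType hHD hY p z).1 hz)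
  have halgZ : ∀ (p : ℕ), ∀ z ∈ (BettiUniverse.hodge hHD hZ (2 * p)).hodgeClasses (p : ℤ), ofRatClass (ComplexPoints Z) (2 * p) z ∈ algebraicClasses Z p :=
    fun p z hz ↦ hHCZ.2 p _ (isRationalClass_ofRatClass _) ((BettiUniverse.mem_hodgeClasses_hodge_iff_isOfHodgeType hHD hZ p z).1 hz)
  refine BettiUniverse.hodgeConjectureFor_tensor_of_kunneth_pieces_pos_le hHD hY hZ hYZ hHCY hHCZ fun c i j hij _ _ hj1 hj _ t ht ↦ ?_
  by_cases him : i = m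
  · have hmi : m = i := him.symm
    subst hmi
    exact hmid c j hij hj1 hj t ht
  rcases Nat.even_or_odd i with ⟨a, ha⟩ | hio
  · obtain ⟨a, rfl⟩ : ∃ a', i = 2 * a' := ⟨a, by omega⟩
    obtain ⟨b, rfl⟩ : ∃ b, j = 2 * b := ⟨j / 2, by omega⟩
    exact BettiUniverse.ofRatClass_crossMap_mem_algebraicClasses_of_hodgeClasses_eq_top_left hHD hY hZ hij (heven a him)
      (fun z ↦ halgY a z (by rw [heven a him]; exact Submodule.mem_top)) (halgZ b) ht
  · exact BettiUniverse.ofRatClass_crossMap_mem_algebraicClasses_of_finrank_eq_zero hY hZ hij (Or.inl (hodd i hio him)) t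

/-- **The mirror: `HC(Y × Z)` with `Z` off-middle algebraic (right factor)** — only the pieces `Hⁱ(Y) ⊗ Hⁿ(Z)`, `1 ≤ i ≤ m`, have to be checked.
[cite: VoisinHodgeI2002, §11.3.3 Thm. 11.38–11.40, Lemma 11.41 and p. 287] [cite: DeligneHodgeII1971, 2.1.13] [cite: Arapura2001HodgeCyclesModuli, Lemma 9 and Cor. 10] -/
theorem BettiUniverse.hodgeConjectureFor_tensor_of_offMiddle_algebraic_right (hHD : exists_isReal_hodgeModel) (hY : IsSmoothProjective m Y) (hZ : IsSmoothProjective n Z)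
    (hYZ : IsSmoothProjective d (Y ⊗ Z)) (hHCY : HodgeConjectureFor m Y) (hHCZ : HodgeConjectureFor n Z) (hodd : ∀ k, Odd k → k ≠ n → Module.finrank ℚ (bettiCohomology Z k) = 0)
    (heven : ∀ p, 2 * p ≠ n → (BettiUniverse.hodge hHD hZ (2 * p)).hodgeClasses p = ⊤)
    (hmid : ∀ (c i : ℕ) (hin : i + n = 2 * c), 1 ≤ i → i ≤ m →
      ∀ t ∈ (BettiUniverse.kunnethSummand hHD hY hZ (2 * c) ⟨(i, n), HasAntidiagonal.mem_antidiagonal.2 hin⟩).hodgeClasses c,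
        ofRatClass (ComplexPoints (Y ⊗ Z)) (2 * c) (BettiUniverse.crossMap Y Z hin t) ∈ algebraicClasses (Y ⊗ Z) c) :
    HodgeConjectureFor d (Y ⊗ Z) := by
  have halgY : ∀ (p : ℕ), ∀ z ∈ (BettiUniverse.hodge hHD hY (2 * p)).hodgeClasses (p : ℤ), ofRatClass (ComplexPoints Y) (2 * p) z ∈ algebraicClasses Y p :=
    fun p z hz ↦ hHCY.2 p _ (isRationalClass_ofRatClass _) ((BettiUniverse.mem_hodgeClasses_hodge_iff_isOfHodgeType hHD hY p z).1 hz)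
  have halgZ : ∀ (p : ℕ), ∀ z ∈ (BettiUniverse.hodge hHD hZ (2 * p)).hodgeClasses (p : ℤ), ofRatClass (ComplexPoints Z) (2 * p) z ∈ algebraicClasses Z p :=
    fun p z hz ↦ hHCZ.2 p _ (isRationalClass_ofRatClass _) ((BettiUniverse.mem_hodgeClasses_hodge_iff_isOfHodgeType hHD hZ p z).1 hz)
  refine BettiUniverse.hodgeConjectureFor_tensor_of_kunneth_pieces_pos_le hHD hY hZ hYZ hHCY hHCZ fun c i j hij hi1 hi _ _ _ t ht ↦ ?_
  by_cases hjn : j = n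
  · have hnj : n = j := hjn.symm
    subst hnj
    exact hmid c i hij hi1 hi t ht
  rcases Nat.even_or_odd j with ⟨b, hb⟩ | hjo
  · obtain ⟨b, rfl⟩ : ∃ b', j = 2 * b' := ⟨b, by omega⟩
    obtain ⟨a, rfl⟩ : ∃ a, i = 2 * a := ⟨i / 2, by omega⟩
    exact BettiUniverse.ofRatClass_crossMap_mem_algebraicClasses_of_hodgeClasses_eq_top_right hHD hY hZ hij (heven b hjn) (halgY a)
      (fun z ↦ halgZ b z (by rw [heven b hjn]; exact Submodule.mem_top)) ht
  · exact BettiUniverse.ofRatClass_crossMap_mem_algebraicClasses_of_finrank_eq_zero hY hZ hij (Or.inr (hodd j hjo hjn)) t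

/-- **Both factors off-middle algebraic: only the piece `Hᵐ(Y) ⊗ Hⁿ(Z)` matters.**  If `Y` (dimension `m`) and `Z` (dimension `n`) are off-middle algebraic with `HC(Y)`, `HC(Z)`, and the Hodge
classes of `Hᵐ(Y) ⊗ Hⁿ(Z)` (when `m + n = 2c`) have algebraic cross products, then `HC(Y × Z)`. [cite: VoisinHodgeI2002, §11.3.3 Thm. 11.38–11.40, Lemma 11.41 and p. 287] [cite: DeligneHodgeII1971, 2.1.13] -/
theorem BettiUniverse.hodgeConjectureFor_tensor_of_offMiddle_algebraic (hHD : exists_isReal_hodgeModel) (hY : IsSmoothProjective m Y) (hZ : IsSmoothProjective n Z)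
    (hYZ : IsSmoothProjective d (Y ⊗ Z)) (hHCY : HodgeConjectureFor m Y) (hHCZ : HodgeConjectureFor n Z) (hoddY : ∀ k, Odd k → k ≠ m → Module.finrank ℚ (bettiCohomology Y k) = 0)
    (hevenY : ∀ p, 2 * p ≠ m → (BettiUniverse.hodge hHD hY (2 * p)).hodgeClasses p = ⊤) (hoddZ : ∀ k, Odd k → k ≠ n → Module.finrank ℚ (bettiCohomology Z k) = 0)
    (hevenZ : ∀ p, 2 * p ≠ n → (BettiUniverse.hodge hHD hZ (2 * p)).hodgeClasses p = ⊤)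
    (hmid : ∀ (c : ℕ) (hmn : m + n = 2 * c), ∀ t ∈ (BettiUniverse.kunnethSummand hHD hY hZ (2 * c) ⟨(m, n), HasAntidiagonal.mem_antidiagonal.2 hmn⟩).hodgeClasses c,
      ofRatClass (ComplexPoints (Y ⊗ Z)) (2 * c) (BettiUniverse.crossMap Y Z hmn t) ∈ algebraicClasses (Y ⊗ Z) c) :
    HodgeConjectureFor d (Y ⊗ Z) := by
  have halgY : ∀ (p : ℕ), ∀ z ∈ (BettiUniverse.hodge hHD hY (2 * p)).hodgeClasses (p : ℤ), ofRatClass (ComplexPoints Y) (2 * p) z ∈ algebraicClasses Y p :=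
    fun p z hz ↦ hHCY.2 p _ (isRationalClass_ofRatClass _) ((BettiUniverse.mem_hodgeClasses_hodge_iff_isOfHodgeType hHD hY p z).1 hz)
  have halgZ : ∀ (p : ℕ), ∀ z ∈ (BettiUniverse.hodge hHD hZ (2 * p)).hodgeClasses (p : ℤ), ofRatClass (ComplexPoints Z) (2 * p) z ∈ algebraicClasses Z p :=
    fun p z hz ↦ hHCZ.2 p _ (isRationalClass_ofRatClass _) ((BettiUniverse.mem_hodgeClasses_hodge_iff_isOfHodgeType hHD hZ p z).1 hz)
  refine BettiUniverse.hodgeConjectureFor_tensor_of_offMiddle_algebraic_left hHD hY hZ hYZ hHCY hHCZ hoddY hevenY fun c j hmj _ _ t ht ↦ ?_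
  by_cases hjn : j = n
  · have hnj : n = j := hjn.symm
    subst hnj
    exact hmid c hmj t ht
  rcases Nat.even_or_odd j with ⟨b, hb⟩ | hjo
  · obtain ⟨b, rfl⟩ : ∃ b', j = 2 * b' := ⟨b, by omega⟩
    obtain ⟨a, hma⟩ : ∃ a, m = 2 * a := ⟨m / 2, by omega⟩
    subst hma
    exact BettiUniverse.ofRatClass_crossMap_mem_algebraicClasses_of_hodgeClasses_eq_top_right hHD hY hZ hmj (hevenZ b hjn) (halgY a)
      (fun z ↦ halgZ b z (by rw [hevenZ b hjn]; exact Submodule.mem_top)) ht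
  · exact BettiUniverse.ofRatClass_crossMap_mem_algebraicClasses_of_finrank_eq_zero hY hZ hmj (Or.inr (hoddZ j hjo hjn)) t

/-- **Both factors off-middle algebraic and NO Hodge class in `Hᵐ(Y) ⊗ Hⁿ(Z)`: `HC(Y × Z) ⟸ HC(Y), HC(Z)`.** [cite: VoisinHodgeI2002, §11.3.3 Thm. 11.38–11.40, Lemma 11.41 and p. 287] -/
theorem BettiUniverse.hodgeConjectureFor_tensor_of_offMiddle_algebraic_of_hodgeClasses_eq_bot (hHD : exists_isReal_hodgeModel) (hY : IsSmoothProjective m Y) (hZ : IsSmoothProjective n Z)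
    (hYZ : IsSmoothProjective d (Y ⊗ Z)) (hHCY : HodgeConjectureFor m Y) (hHCZ : HodgeConjectureFor n Z)
    (hoddY : ∀ k, Odd k → k ≠ m → Module.finrank ℚ (bettiCohomology Y k) = 0) (hevenY : ∀ p, 2 * p ≠ m → (BettiUniverse.hodge hHD hY (2 * p)).hodgeClasses p = ⊤)
    (hoddZ : ∀ k, Odd k → k ≠ n → Module.finrank ℚ (bettiCohomology Z k) = 0) (hevenZ : ∀ p, 2 * p ≠ n → (BettiUniverse.hodge hHD hZ (2 * p)).hodgeClasses p = ⊤)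
    (hbot : ∀ c : ℕ, m + n = 2 * c → ((BettiUniverse.hodge hHD hY m).tensor (BettiUniverse.hodge hHD hZ n)).hodgeClasses (c : ℤ) = ⊥) :
    HodgeConjectureFor d (Y ⊗ Z) := by
  refine BettiUniverse.hodgeConjectureFor_tensor_of_offMiddle_algebraic hHD hY hZ hYZ hHCY hHCZ hoddY hevenY hoddZ hevenZ fun c hc t ht ↦ ?_
  have ht' : t ∈ ((BettiUniverse.hodge hHD hY m).tensor (BettiUniverse.hodge hHD hZ n)).hodgeClasses (c : ℤ) := by
    change t ∈ (((BettiUniverse.hodge hHD hY m).tensor (BettiUniverse.hodge hHD hZ n)).cast _).hodgeClasses _ at ht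
    rw [HodgeStructure.cast_hodgeClasses] at ht
    exact ht
  rw [hbot c hc, Submodule.mem_bot] at ht'
  rw [ht', map_zero, map_zero]
  exact Submodule.zero_mem _

omit [HodgeTensorFacts.{0, 0}] in
/-- **Hom form**: both factors off-middle algebraic and `Hom_HS(Hᵐ(Y), Hⁿ(Z)(s)) = 0` for the twist `s` with `n − 2s = m` (Lemma 11.41: `Hdg(HᵐY ⊗ HⁿZ) ≅ Hom_HS(HᵐY^∨, HⁿZ)(c)`, and `HᵐY^∨ ≅ HᵐY(m)` by a
polarization) ⇒ `HC(Y × Z) ⟸ HC(Y), HC(Z)`. [cite: VoisinHodgeI2002, §11.3.3 Lemma 11.41 and §7.1.2] -/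
theorem BettiUniverse.hodgeConjectureFor_tensor_of_offMiddle_algebraic_of_subsingleton_hom (hHD : exists_isReal_hodgeModel) (hY : IsSmoothProjective m Y) (hZ : IsSmoothProjective n Z)
    (hYZ : IsSmoothProjective d (Y ⊗ Z)) (hHCY : HodgeConjectureFor m Y) (hHCZ : HodgeConjectureFor n Z)
    (hoddY : ∀ k, Odd k → k ≠ m → Module.finrank ℚ (bettiCohomology Y k) = 0) (hevenY : ∀ p, 2 * p ≠ m → (BettiUniverse.hodge hHD hY (2 * p)).hodgeClasses p = ⊤)
    (hoddZ : ∀ k, Odd k → k ≠ n → Module.finrank ℚ (bettiCohomology Z k) = 0) (hevenZ : ∀ p, 2 * p ≠ n → (BettiUniverse.hodge hHD hZ (2 * p)).hodgeClasses p = ⊤)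
    (hHom : ∀ (s : ℤ) (hs : (n : ℤ) - 2 * s = m), Subsingleton (HodgeStructure.Hom (BettiUniverse.hodge hHD hY m) (((BettiUniverse.hodge hHD hZ n).tateTwist s).cast hs))) :
    HodgeConjectureFor d (Y ⊗ Z) := by
  haveI : HodgeTensorFacts.{0, 0} := hodgeTensorFacts_holds
  refine BettiUniverse.hodgeConjectureFor_tensor_of_offMiddle_algebraic_of_hodgeClasses_eq_bot hHD hY hZ hYZ hHCY hHCZ hoddY hevenY hoddZ hevenZ fun c hc ↦ ?_
  have hs : (n : ℤ) - 2 * ((c : ℤ) - m) = m := by omega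
  have h := (BettiUniverse.hodgeClasses_tensor_hodge_eq_bot_iff_subsingleton_hom_tateTwist hHD hY hZ m n hs).2 (hHom _ hs)
  rwa [show (m : ℤ) + ((c : ℤ) - m) = (c : ℤ) by ring] at h

end OneFactor

end Literature.AlgebraicGeometry.HodgeTheory

/-! ### §2 Smooth hypersurfaces -/

namespace Literature.AlgebraicGeometry.Motives.IsSmoothHypersurface

open Literature.AlgebraicGeometry.Motives
open Literature.AlgebraicGeometry.HodgeTheory

variable {m n e e' : ℕ} {Y Y' Z S : SchemeOver ℂ}

/-- The data of a smooth hypersurface: a NON-ZERO defining form of degree `e` cutting it out. [cite: Hartshorne1977, I Ex. 2.9 and II Ex. 2.9] -/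
private theorem exists_cutOut (hY : IsSmoothHypersurface m e Y) : ∃ F : MvPolynomial (Fin (m + 2)) ℂ, F.IsHomogeneous e ∧ F ≠ 0 ∧ IsHypersurfaceCutOutBy (m + 1) F Y := by
  obtain ⟨F, hFhom, hFirr, hcut⟩ := hY.2
  exact ⟨F, hFhom, hFirr.ne_zero, hcut⟩

/-- **`b_k(Y) = 0` for `k` odd, `k ≠ dim Y`**, `Y ⊂ ℙ^{m+1}_ℂ` a smooth hypersurface (Lefschetz below the middle, Poincaré duality above; the tree's `subsingleton_bettiCohomology_of_odd`).
[cite: VoisinHodgeII2003, §1.2.2 Thm. 1.23 and §1.2.3 Cor. 1.24–1.25] -/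
theorem finrank_bettiCohomology_eq_zero_of_odd (hY : IsSmoothHypersurface m e Y) {k : ℕ} (hk : Odd k) (hkm : k ≠ m) : Module.finrank ℚ (bettiCohomology Y k) = 0 := by
  obtain ⟨F, hFhom, hF0, hcut⟩ := hY.exists_cutOut
  haveI := subsingleton_bettiCohomology_of_odd hY.1 hFhom hF0 hcut hk hkm
  exact Module.finrank_zero_of_subsingleton

/-- **`Hdgᵖ(H^{2p}Y) = H^{2p}(Y;ℚ)` for `2p ≠ dim Y`**: off the middle degree every class of a smooth hypersurface is algebraic (`Nᵖ(Y) = H^{2p}(Y;ℂ)`, the tree's PROVED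
`Voisin2003_smoothHypersurface_algebraicClasses_eq_top_holds`), hence a Hodge class. [cite: VoisinHodgeII2003, §1.2.3 Cor. 1.24 and Cor. 1.25] [cite: VoisinHodgeI2002, §11.1.2 Prop. 11.20] -/
theorem hodgeClasses_hodge_eq_top_of_two_mul_ne (hY : IsSmoothHypersurface m e Y) (hHD : exists_isReal_hodgeModel) (hX : IsSmoothProjective m Y) {p : ℕ} (hp : 2 * p ≠ m) :
    (BettiUniverse.hodge hHD hX (2 * p)).hodgeClasses p = ⊤ :=
  BettiUniverse.hodgeClasses_hodge_eq_top_of_algebraicClasses_eq_top hHD hX (Voisin2003_smoothHypersurface_algebraicClasses_eq_top_holds.of_two_mul_ne hY p hp)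

/-- For a smooth hypersurface of ODD dimension every `Hdgᵖ(H^{2p}Y)` is all of `H^{2p}(Y;ℚ)` (`2p ≠ m` automatically). [cite: VoisinHodgeII2003, §1.2.3 Cor. 1.24 and Cor. 1.25] -/
theorem hodgeClasses_hodge_eq_top_of_odd (hY : IsSmoothHypersurface m e Y) (hHD : exists_isReal_hodgeModel) (hX : IsSmoothProjective m Y) (hm : Odd m) (p : ℕ) :
    (BettiUniverse.hodge hHD hX (2 * p)).hodgeClasses p = ⊤ :=
  hY.hodgeClasses_hodge_eq_top_of_two_mul_ne hHD hX fun h ↦ (Nat.not_even_iff_odd.2 hm) ⟨p, by omega⟩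

/-- **`HC(Y)` for a smooth hypersurface of ODD dimension** (all of `H^{2p}(Y;ℂ)`, `2p ≠ m`, is algebraic; the tree's `hodgeConjectureFor_of_isHypersurfaceCutOutBy_of_odd`).
[cite: VoisinHodgeII2003, §1.2.3 Cor. 1.24 and Cor. 1.25] -/
theorem hodgeConjectureFor_of_odd (hY : IsSmoothHypersurface m e Y) (hHD : exists_isReal_hodgeModel) (hm : Odd m) : HodgeConjectureFor m Y := by
  obtain ⟨F, hFhom, -, hcut⟩ := hY.exists_cutOut
  exact hodgeConjectureFor_of_isHypersurfaceCutOutBy_of_odd hHD hY.1 hm hFhom hcut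

/-- **`HC(Y × Z)` for `Y` a smooth hypersurface of ODD dimension `m` and `Z` any smooth projective variety with `HC(Z)` and no odd cohomology** (e.g. `Z` a surface with `q = 0`, an
even-dimensional smooth hypersurface or complete intersection satisfying `HC`, a variety with algebraic cohomology): `Y` has even cohomology of pure type and `HC(Y)` (Cor. 1.24/1.25), so the
seat's g27-#5 transfer `BettiUniverse.hodgeConjectureFor_tensor_of_pure_even_of_odd_vanishing` (no exceptional Hodge classes, Lemma 11.41) applies. [cite: VoisinHodgeII2003, §1.2.3 Cor. 1.24 and Cor. 1.25]
[cite: VoisinHodgeI2002, §11.3.3 Thm. 11.38, Lemma 11.41 and p. 287] [cite: Arapura2001HodgeCyclesModuli, Lemma 9 and Cor. 10] -/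
theorem hodgeConjectureFor_tensor_of_odd (hY : IsSmoothHypersurface m e Y) (hHD : exists_isReal_hodgeModel) (hm : Odd m) (hZ : IsSmoothProjective n Z) (hHCZ : HodgeConjectureFor n Z)
    (hoddZ : ∀ k, Odd k → Module.finrank ℚ (bettiCohomology Z k) = 0) : HodgeConjectureFor (m + n) (Y ⊗ Z) := by
  haveI : HodgeTensorFacts.{0, 0} := hodgeTensorFacts_holds
  exact BettiUniverse.hodgeConjectureFor_tensor_of_pure_even_of_odd_vanishing hHD hY.1 hZ (hY.1.tensor_holds hZ) (hY.hodgeClasses_hodge_eq_top_of_odd hHD hY.1 hm) hoddZ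
    (hY.hodgeConjectureFor_of_odd hHD hm) hHCZ

/-- Mirror: **`HC(Z × Y)`** for `Z` with `HC(Z)` and no odd cohomology and `Y` a smooth hypersurface of odd dimension (g27-#5 `BettiUniverse.hodgeConjectureFor_tensor_of_odd_vanishing_of_pure_even`).
[cite: VoisinHodgeII2003, §1.2.3 Cor. 1.24 and Cor. 1.25] [cite: VoisinHodgeI2002, §11.3.3 Thm. 11.38, Lemma 11.41 and p. 287] -/
theorem hodgeConjectureFor_tensor_of_odd_right (hY : IsSmoothHypersurface n e Y) (hHD : exists_isReal_hodgeModel) (hn : Odd n) (hZ : IsSmoothProjective m Z) (hHCZ : HodgeConjectureFor m Z)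
    (hoddZ : ∀ k, Odd k → Module.finrank ℚ (bettiCohomology Z k) = 0) : HodgeConjectureFor (m + n) (Z ⊗ Y) := by
  haveI : HodgeTensorFacts.{0, 0} := hodgeTensorFacts_holds
  exact BettiUniverse.hodgeConjectureFor_tensor_of_odd_vanishing_of_pure_even hHD hZ hY.1 (hZ.tensor_holds hY.1) hoddZ (hY.hodgeClasses_hodge_eq_top_of_odd hHD hY.1 hn) hHCZ
    (hY.hodgeConjectureFor_of_odd hHD hn)

/-- **`HC(Y × Y')` for `Y` a smooth hypersurface of ODD dimension and `Y'` a smooth hypersurface of EVEN dimension satisfying `HC(Y')`** (quadrics, cubic fourfolds, Fermat hypersurfaces of the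
known degrees, …): `Y'` has no odd cohomology at all. [cite: VoisinHodgeII2003, §1.2.3 Cor. 1.24 and Cor. 1.25] [cite: VoisinHodgeI2002, §11.3.3 Thm. 11.38, Lemma 11.41 and p. 287] -/
theorem hodgeConjectureFor_tensor_hypersurface_of_odd_of_even (hY : IsSmoothHypersurface m e Y) (hY' : IsSmoothHypersurface n e' Y') (hHD : exists_isReal_hodgeModel) (hm : Odd m) (hn : Even n)
    (hHC' : HodgeConjectureFor n Y') : HodgeConjectureFor (m + n) (Y ⊗ Y') :=
  hY.hodgeConjectureFor_tensor_of_odd hHD hm hY'.1 hHC' fun _ hk ↦ hY'.finrank_bettiCohomology_eq_zero_of_odd hk fun h ↦ (Nat.not_even_iff_odd.2 hk) (h ▸ hn)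

/-- Mirror: **`HC(Y' × Y)`**, `Y'` of even dimension with `HC(Y')`, `Y` of odd dimension. [cite: VoisinHodgeII2003, §1.2.3 Cor. 1.24 and Cor. 1.25] [cite: VoisinHodgeI2002, §11.3.3 Thm. 11.38, Lemma 11.41 and p. 287] -/
theorem hodgeConjectureFor_tensor_hypersurface_of_even_of_odd (hY' : IsSmoothHypersurface n e' Y') (hY : IsSmoothHypersurface m e Y) (hHD : exists_isReal_hodgeModel) (hn : Even n) (hm : Odd m)
    (hHC' : HodgeConjectureFor n Y') : HodgeConjectureFor (n + m) (Y' ⊗ Y) :=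
  hY.hodgeConjectureFor_tensor_of_odd_right hHD hm hY'.1 hHC' fun _ hk ↦ hY'.finrank_bettiCohomology_eq_zero_of_odd hk fun h ↦ (Nat.not_even_iff_odd.2 hk) (h ▸ hn)

/-- **`HC(Y × Y')` for two smooth hypersurfaces of ODD dimensions `m`, `m'` with no Hodge class in `Hᵐ(Y) ⊗ Hᵐ'(Y')`** (i.e. `Hom_HS(HᵐY, Hᵐ'Y'((m'−m)/2)) = 0`; e.g. non-isogenous «generic»
members): both factors are off-middle algebraic with `HC`. [cite: VoisinHodgeII2003, §1.2.3 Cor. 1.24 and Cor. 1.25] [cite: VoisinHodgeI2002, §11.3.3 Thm. 11.38–11.40, Lemma 11.41 and p. 287] -/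
theorem hodgeConjectureFor_tensor_hypersurface_of_odd_of_odd [HodgeTensorFacts.{0, 0}] (hY : IsSmoothHypersurface m e Y) (hY' : IsSmoothHypersurface n e' Y') (hHD : exists_isReal_hodgeModel) (hm : Odd m) (hn : Odd n)
    (hbot : ∀ c : ℕ, m + n = 2 * c → ((BettiUniverse.hodge hHD hY.1 m).tensor (BettiUniverse.hodge hHD hY'.1 n)).hodgeClasses (c : ℤ) = ⊥) : HodgeConjectureFor (m + n) (Y ⊗ Y') :=
  BettiUniverse.hodgeConjectureFor_tensor_of_offMiddle_algebraic_of_hodgeClasses_eq_bot hHD hY.1 hY'.1 (hY.1.tensor_holds hY'.1) (hY.hodgeConjectureFor_of_odd hHD hm)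
    (hY'.hodgeConjectureFor_of_odd hHD hn) (fun _ hk hkm ↦ hY.finrank_bettiCohomology_eq_zero_of_odd hk hkm) (fun _ hp ↦ hY.hodgeClasses_hodge_eq_top_of_two_mul_ne hHD hY.1 hp)
    (fun _ hk hkn ↦ hY'.finrank_bettiCohomology_eq_zero_of_odd hk hkn) (fun _ hp ↦ hY'.hodgeClasses_hodge_eq_top_of_two_mul_ne hHD hY'.1 hp) hbot

/-- Hom form of the previous statement: `Hom_HS(HᵐY, HⁿY'(s)) = 0` for the twist `n − 2s = m`. [cite: VoisinHodgeI2002, §11.3.3 Lemma 11.41 and §7.1.2] [cite: VoisinHodgeII2003, §1.2.3 Cor. 1.24 and Cor. 1.25] -/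
theorem hodgeConjectureFor_tensor_hypersurface_of_odd_of_odd_of_subsingleton_hom (hY : IsSmoothHypersurface m e Y) (hY' : IsSmoothHypersurface n e' Y') (hHD : exists_isReal_hodgeModel)
    (hm : Odd m) (hn : Odd n)
    (hHom : ∀ (s : ℤ) (hs : (n : ℤ) - 2 * s = m), Subsingleton (HodgeStructure.Hom (BettiUniverse.hodge hHD hY.1 m) (((BettiUniverse.hodge hHD hY'.1 n).tateTwist s).cast hs))) :
    HodgeConjectureFor (m + n) (Y ⊗ Y') :=
  BettiUniverse.hodgeConjectureFor_tensor_of_offMiddle_algebraic_of_subsingleton_hom hHD hY.1 hY'.1 (hY.1.tensor_holds hY'.1) (hY.hodgeConjectureFor_of_odd hHD hm)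
    (hY'.hodgeConjectureFor_of_odd hHD hn) (fun _ hk hkm ↦ hY.finrank_bettiCohomology_eq_zero_of_odd hk hkm) (fun _ hp ↦ hY.hodgeClasses_hodge_eq_top_of_two_mul_ne hHD hY.1 hp)
    (fun _ hk hkn ↦ hY'.finrank_bettiCohomology_eq_zero_of_odd hk hkn) (fun _ hp ↦ hY'.hodgeClasses_hodge_eq_top_of_two_mul_ne hHD hY'.1 hp) hHom

/-- **`HC(Y × Y)` for a smooth hypersurface `Y` with `HC(Y)` and `dim_ℚ End_HS(HᵐY) ≤ 1`** (any dimension `m`; g29-#6 on the off-middle-algebraic `Y`: the middle Künneth component of `[Δ_Y]`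
spans `Hdgᵐ(HᵐY ⊗ HᵐY)`). [cite: VoisinHodgeII2003, §1.2.3 Cor. 1.24 and Cor. 1.25] [cite: VoisinHodgeI2002, §11.3.3 Lemma 11.41 and p. 287] [cite: Voisin2025, §3.2.1 (12)–(14)] -/
theorem hodgeConjectureFor_tensor_self_of_finrank_end_le_one (hY : IsSmoothHypersurface m e Y) (hHD : exists_isReal_hodgeModel) (hHC : HodgeConjectureFor m Y)
    (hEnd : Module.finrank ℚ (HodgeStructure.Hom (BettiUniverse.hodge hHD hY.1 m) (BettiUniverse.hodge hHD hY.1 m)) ≤ 1) : HodgeConjectureFor (m + m) (Y ⊗ Y) :=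
  BettiUniverse.hodgeConjectureFor_tensor_self_of_offMiddle_algebraic_of_finrank_end_le_one hHD hY.1 (hY.1.tensor_holds hY.1) hHC
    (fun _ hk hkm ↦ hY.finrank_bettiCohomology_eq_zero_of_odd hk hkm) (fun _ hp ↦ hY.hodgeClasses_hodge_eq_top_of_two_mul_ne hHD hY.1 hp) hEnd

/-- **`HC(Y × Y)` for a smooth hypersurface `Y` of ODD dimension with `dim_ℚ End_HS(HᵐY) ≤ 1`** — e.g. the general hypersurface of odd dimension `m ≥ 3` and degree `≥ 3` (big monodromy),
UNCONDITIONALLY in `Y` otherwise. [cite: VoisinHodgeII2003, §1.2.3 Cor. 1.24 and Cor. 1.25] [cite: VoisinHodgeI2002, §11.3.3 Lemma 11.41 and p. 287] [cite: Voisin2025, §3.2.1 (12)–(14)] [cite: Deligne2000, §1] -/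
theorem hodgeConjectureFor_tensor_self_of_odd_of_finrank_end_le_one (hY : IsSmoothHypersurface m e Y) (hHD : exists_isReal_hodgeModel) (hm : Odd m)
    (hEnd : Module.finrank ℚ (HodgeStructure.Hom (BettiUniverse.hodge hHD hY.1 m) (BettiUniverse.hodge hHD hY.1 m)) ≤ 1) : HodgeConjectureFor (m + m) (Y ⊗ Y) :=
  hY.hodgeConjectureFor_tensor_self_of_finrank_end_le_one hHD (hY.hodgeConjectureFor_of_odd hHD hm) hEnd

end Literature.AlgebraicGeometry.Motives.IsSmoothHypersurface

end
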